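import Summits.QuantumFields.BalabanUV.Beta.GAN24.CubicSectorCurrentExpansion
import Summits.QuantumFields.BalabanUV.Beta.GAN24.ExitFaceCurrentTowerStep
import Summits.QuantumFields.BalabanUV.Beta.StepReflectionRec

/-!
# `BalabanUV.Beta.GAN24.CubicSectorCurrentSym` — binder row G-an2-4 ∕ (CONV-C), W-slot CT-W, conservation law (C)∕(C)sym AT ALL LEVELS, THE INDUCTION STEP OF THE (A)-TOWER of this
# lineage's note `HOME/b2b-balaban-gan24-formalise-leaf-04/g68/EXIT-FACE-CURRENT-TOWER.md` §2 (I6): **IF EVERY SLOT↔LEG-SYMMETRISED CLASS-WEIGHTED TWO-LEG CURRENT OF THE LEVEL-`j` TABLE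
# FAMILY `S` VANISHES AT EVERY FREE LEG (FIELD AND MULTIPLIER), THEN SO DOES EVERY SUCH CURRENT OF ITS CUBIC SECTOR `e3OfK Lc G_j S` ONE LEVEL UP** — class = «constant + lattice
# gradient of a bounded single-coordinate function, supported on the exit faces `n ≡ −1 (mod Lc)`» (the responses of `CoordinateProfileResponses.tsum_profile_mul_colH` are in it).

NOT IN PRINT; OUR BOOKKEEPING ([folklore] bookkeeping BY NAME over this gen's `CubicSectorCurrentExpansion.faceSlot_current_eq_tsum_freeLeg` and g68's `CoordinateProfileResponses`,
`ExitFaceCurrentTowerStep.tsum_rescale ∕ sum_tsum_ite_dir`; G-an2-4 formalisation swarm, leaf prover `b2b-balaban-gan24-formalise-leaf-04`, gen 69).  HONEST FRAMING (cell contract,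
verbatim): «discharging `BetaPertH` makes Bałaban's UV stability UNCONDITIONAL — a real constructive-QFT result; it is NOT the continuum limit and NOT the Clay problem.»  HONEST DEPENDENCY
(verbatim): «continuum YM on T⁴ ⇐ BetaPertH ∧ nine spine estimates (0/9 proved); BetaPertH ⇐ (D1) ∧ (D4) ∧ CAP+tail; G-an2-4 gates asym, D1 and NE2/3/4.»

CONVENTION (weighted leg FIRST, free leg `(p, a)` SECOND — the step is then parity-free): the symmetrised current of a table family `T` for data `h` (direction `β`) and `s` (direction `ν`) is
`P_T[s,h](p,a) := Σ'_q h(q_β)·Σ'_u s(u_ν)·T ν u q p (inl β) a + Σ'_q s(q_ν)·Σ'_u h(u_β)·T β u q p (inl ν) a`.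

WHAT ([folklore]; generic `d`, `[NeZero Lc]`, in-block root `r ∈ box Lc`, every `j`, ANY local table family `S`; 0 `def`, 0 cited facts, 0 `def … : Prop`, 0 sorry): §1 `face_support_of_response` (no multiplier free legs: an5's `StepReflectionRec` (`SpineRooted.e3OfK_inl_inr`)) (the rescaled response `A·Lc⁻¹∕M + dΨ` of a class datum vanishes off the exit faces); §2 **`sym_e3OfK_of_sym`**: hypothesis = for all
face-supported class data `(c₁,Ψ₁)`, `(c₂,Ψ₂)` (bounded `Ψ`'s) and all free legs `(p,a)`, `P_S[c₂+dΨ₂, c₁+dΨ₁](p,a) = 0`; conclusion = for all bounded class data `(c,Φ)`, `(c′,Φ′)` (face support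
NOT needed on top) and all free legs `(y,a′)`, `P_{e3OfK Lc G_j S}[c′+dΦ′, c+dΦ](y,a′) = 0`.  Asserts NO value of Bałaban's tables; discharges NOTHING of (C)sym ∕ (Q-D) ∕ (Q-D-rate) ∕
«T2Shape» ∕ «T2Drift» ∕ (hW, hWall); NEVER «G-an2-4 closed» as (CONV-C); NOT D1, NOT `BetaPertH`, NOT continuum, NOT Clay.  2026-08-23; no existing file touched.
-/

noncomputable section

open Finset
open scoped BigOperators
open Literature.MathematicalPhysics.QuantumFieldTheory
open Literature.MathematicalPhysics.QuantumFieldTheory.Balaban1983to89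
open Literature.MathematicalPhysics.QuantumFieldTheory.Balaban1983to89.Beta
open ExpKernelCalculus (Site MKer)
open AffineAveraging (box toSite)
open OneStepResolventKernel (Fib LocStencil)
open OneStepKernelFamily (KInvStep colH)
open BalabanStepJetsSucc (mmRead)
open Summit.QuantumFields.BalabanUV.Beta.BorderedHessian (stepScale)
open Summit.QuantumFields.BalabanUV.Beta.AxialDressingRooted (coDressKBmAt)
open Summit.QuantumFields.BalabanUV.Beta.SpineRooted (e3OfK e3OfK_apply e3OfK_inl_inr)
open Summit.QuantumFields.BalabanUV.Beta.GAN24.CoordinateProfileResponses (tsum_profile_mul_dressed_mm_eq_zero tsum_profile_mul_colH tsum_profile_mul_colH_eq_const_add_grad abs_Psi_le)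
open Summit.QuantumFields.BalabanUV.Beta.GAN24.ExitFaceCurrentTowerStep (tsum_rescale sum_tsum_ite_dir)
open Summit.QuantumFields.BalabanUV.Beta.GAN24.CubicSectorCurrentExpansion (faceSlot_current_eq_tsum_freeLeg)

namespace Summit.QuantumFields.BalabanUV.Beta.GAN24.CubicSectorCurrentSym

variable {d : ℕ} {Lc : ℕ} [NeZero Lc] {r : Fin (d + 1) → ℕ} {S : Fin (d + 1) → (Fin (d + 1) → ℤ) → MKer (d + 1) (Fib d)} {Cs δs : ℝ}

/-! ## §1 A bookkeeping lemma -/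

/-- [folklore] **THE RESPONSE OF A CLASS DATUM IS SUPPORTED ON THE EXIT FACES**: with `A := c·Lc·σ_j`, `cH := (stepScale·Lc^{d+1})⁻¹`, `Ψ(n) := (−(A·Lc⁻¹)·(n % Lc) + cH·Φ(n ∕ Lc)) ∕ M`, the rescaled
response `A·Lc⁻¹∕M + (Ψ(n+1) − Ψ(n))` vanishes for `n % Lc ≠ Lc − 1` (`tsum_profile_mul_colH` vs `tsum_profile_mul_colH_eq_const_add_grad` at a site with `β`-coordinate `n`). -/
theorem face_support_of_response (hr : r ∈ box (d + 1) Lc) (j : ℕ) (β : Fin (d + 1)) (c : ℝ) (Φ : ℤ → ℝ) {B : ℝ} (hΦ : ∀ s, |Φ s| ≤ B) (M : ℝ)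
    (n : ℤ) (hn : n % (Lc : ℤ) ≠ (Lc : ℤ) - 1) :
    (c * ((Lc : ℝ) * ((((Lc ^ (j + 1) : ℕ) : ℝ)) ^ (d + 1 + 1))⁻¹)) * (Lc : ℝ)⁻¹ / M +
      ((-((c * ((Lc : ℝ) * ((((Lc ^ (j + 1) : ℕ) : ℝ)) ^ (d + 1 + 1))⁻¹)) * (Lc : ℝ)⁻¹) * ((((n + 1) % (Lc : ℤ) : ℤ) : ℝ)) + (stepScale d Lc j * (Lc : ℝ) ^ (d + 1))⁻¹ * Φ ((n + 1) / (Lc : ℤ))) / M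
        - (-((c * ((Lc : ℝ) * ((((Lc ^ (j + 1) : ℕ) : ℝ)) ^ (d + 1 + 1))⁻¹)) * (Lc : ℝ)⁻¹) * (((n % (Lc : ℤ) : ℤ) : ℝ)) + (stepScale d Lc j * (Lc : ℝ) ^ (d + 1))⁻¹ * Φ (n / (Lc : ℤ))) / M) = 0 := by
  have h1 := tsum_profile_mul_colH_eq_const_add_grad (d := d) hr j β β c Φ hΦ (fun _ => n)
  have h2 := tsum_profile_mul_colH (d := d) hr j β β c Φ hΦ (fun _ => n)
  rw [h2] at h1
  simp only [true_and, if_true] at h1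
  rw [if_neg hn] at h1
  have h3 : (c * ((Lc : ℝ) * ((((Lc ^ (j + 1) : ℕ) : ℝ)) ^ (d + 1 + 1))⁻¹)) * (Lc : ℝ)⁻¹ +
      ((-((c * ((Lc : ℝ) * ((((Lc ^ (j + 1) : ℕ) : ℝ)) ^ (d + 1 + 1))⁻¹)) * (Lc : ℝ)⁻¹) * ((((n + 1) % (Lc : ℤ) : ℤ) : ℝ)) + (stepScale d Lc j * (Lc : ℝ) ^ (d + 1))⁻¹ * Φ ((n + 1) / (Lc : ℤ)))
        - (-((c * ((Lc : ℝ) * ((((Lc ^ (j + 1) : ℕ) : ℝ)) ^ (d + 1 + 1))⁻¹)) * (Lc : ℝ)⁻¹) * (((n % (Lc : ℤ) : ℤ) : ℝ)) + (stepScale d Lc j * (Lc : ℝ) ^ (d + 1))⁻¹ * Φ (n / (Lc : ℤ)))) = 0 := h1.symm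
  rw [← sub_div, ← add_div, h3, zero_div]

/-! ## §2 The induction step -/

-- heartbeats: this proof elaborates at ≈ 180–200 k (measured by leaf-04 g70 with a global ceiling on the concat cert: fails at 180 000, passes at the default 200 000);
-- the ceiling is doubled so that the hub's `lake build` (which broke `ValueHessianLinearGauge` at the default on 2026-08-24) cannot stall the chain. No statement change.
set_option maxHeartbeats 400000 in
/-- [folklore] **THE (A)-TOWER INDUCTION STEP**: the vanishing of all slot↔leg-symmetrised class-weighted two-leg currents at every free leg passes from the level-`j` table family `S`
(face-supported class data, ALL free legs) to its cubic sector `e3OfK Lc G_j S` (all bounded class data, all free legs). -/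
theorem sym_e3OfK_of_sym (hr : r ∈ box (d + 1) Lc) (j : ℕ) (hS : LocStencil S Cs δs) (hδs : 0 < δs) (ν β : Fin (d + 1))
    (hyp : ∀ (c₁ : ℝ) (Ψ₁ : ℤ → ℝ) (B₁ : ℝ), (∀ s, |Ψ₁ s| ≤ B₁) → (∀ n : ℤ, n % (Lc : ℤ) ≠ (Lc : ℤ) - 1 → c₁ + (Ψ₁ (n + 1) - Ψ₁ n) = 0) →
      ∀ (c₂ : ℝ) (Ψ₂ : ℤ → ℝ) (B₂ : ℝ), (∀ s, |Ψ₂ s| ≤ B₂) → (∀ n : ℤ, n % (Lc : ℤ) ≠ (Lc : ℤ) - 1 → c₂ + (Ψ₂ (n + 1) - Ψ₂ n) = 0) →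
      ∀ (p : Site (d + 1)) (a : Fib d),
        (∑' q : Site (d + 1), (c₁ + (Ψ₁ (q β + 1) - Ψ₁ (q β))) * ∑' u : Site (d + 1), (c₂ + (Ψ₂ (u ν + 1) - Ψ₂ (u ν))) * S ν u q p (Sum.inl β) a) +
          ∑' q : Site (d + 1), (c₂ + (Ψ₂ (q ν + 1) - Ψ₂ (q ν))) * ∑' u : Site (d + 1), (c₁ + (Ψ₁ (u β + 1) - Ψ₁ (u β))) * S β u q p (Sum.inl ν) a = 0)
    (c : ℝ) (Φ : ℤ → ℝ) {B : ℝ} (hΦ : ∀ s, |Φ s| ≤ B) (c' : ℝ) (Φ' : ℤ → ℝ) {B' : ℝ} (hΦ' : ∀ s, |Φ' s| ≤ B') (y : Site (d + 1)) (a' : Fib d) :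
    (∑' w : Site (d + 1), (c + (Φ (w β + 1) - Φ (w β))) * ∑' t : Site (d + 1), (c' + (Φ' (t ν + 1) - Φ' (t ν))) *
        e3OfK Lc (coDressKBmAt (toSite r) Lc (KInvStep (d := d) Lc j)) S ν t w y (Sum.inl β) a') +
      ∑' w : Site (d + 1), (c' + (Φ' (w ν + 1) - Φ' (w ν))) * ∑' t : Site (d + 1), (c + (Φ (t β + 1) - Φ (t β))) *
        e3OfK Lc (coDressKBmAt (toSite r) Lc (KInvStep (d := d) Lc j)) S β t w y (Sum.inl ν) a' = 0 := by
  classical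
  rcases a' with μ | m
  swap
  · simp only [e3OfK_inl_inr Lc, mul_zero, tsum_zero, add_zero]
  have hB : 0 ≤ B := (abs_nonneg _).trans (hΦ 0)
  have hB' : 0 ≤ B' := (abs_nonneg _).trans (hΦ' 0)
  -- rescaled weights with `|·| ≤ 1`
  set Mρ : ℝ := |c| + (B + B) + 1 with hMρ
  set Mσ : ℝ := |c'| + (B' + B') + 1 with hMσ
  have hMρ0 : 0 < Mρ := by positivity
  have hMσ0 : 0 < Mσ := by positivity
  set ρ₁ : Site (d + 1) → ℝ := fun w => (c + (Φ (w β + 1) - Φ (w β))) / Mρ with hρ₁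
  set σ₁ : Site (d + 1) → ℝ := fun t => (c' + (Φ' (t ν + 1) - Φ' (t ν))) / Mσ with hσ₁
  have hρb : ∀ w, |ρ₁ w| ≤ 1 := by
    intro w
    rw [hρ₁, abs_div, abs_of_pos hMρ0, div_le_one hMρ0]
    refine (abs_add_le _ _).trans ?_
    have := (abs_sub (Φ (w β + 1)) (Φ (w β))).trans (add_le_add (hΦ _) (hΦ _))
    linarith
  have hσb : ∀ t, |σ₁ t| ≤ 1 := by
    intro t
    rw [hσ₁, abs_div, abs_of_pos hMσ0, div_le_one hMσ0]
    refine (abs_add_le _ _).trans ?_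
    have := (abs_sub (Φ' (t ν + 1)) (Φ' (t ν))).trans (add_le_add (hΦ' _) (hΦ' _))
    linarith
  -- zero multiplier responses of both rescaled data
  have hMρr : ∀ (m : Fin (d + 1)) (q : Site (d + 1)),
      ∑' w : Site (d + 1), ρ₁ w * coDressKBmAt (toSite r) Lc (KInvStep (d := d) Lc j) q ((Lc : ℤ) • w) (Sum.inr m) (Sum.inr β) = 0 := by
    intro m q
    have h := tsum_profile_mul_dressed_mm_eq_zero (d := d) hr j β m c Φ hΦ q
    rw [tsum_rescale (M := Mρ) hMρ0.ne'] at h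
    simpa [hρ₁, hMρ0.ne'] using h
  have hMσr : ∀ (m : Fin (d + 1)) (q : Site (d + 1)),
      ∑' t : Site (d + 1), σ₁ t * coDressKBmAt (toSite r) Lc (KInvStep (d := d) Lc j) q ((Lc : ℤ) • t) (Sum.inr m) (Sum.inr ν) = 0 := by
    intro m q
    have h := tsum_profile_mul_dressed_mm_eq_zero (d := d) hr j ν m c' Φ' hΦ' q
    rw [tsum_rescale (M := Mσ) hMσ0.ne'] at h
    simpa [hσ₁, hMσ0.ne'] using h
  -- the responses of the rescaled data, explicitly (same class one level down, supported on the exit faces)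
  set A₁ : ℝ := c * ((Lc : ℝ) * ((((Lc ^ (j + 1) : ℕ) : ℝ)) ^ (d + 1 + 1))⁻¹) with hA₁
  set A₂ : ℝ := c' * ((Lc : ℝ) * ((((Lc ^ (j + 1) : ℕ) : ℝ)) ^ (d + 1 + 1))⁻¹) with hA₂
  set cH : ℝ := (stepScale d Lc j * (Lc : ℝ) ^ (d + 1))⁻¹ with hcH
  set Ψ₁ : ℤ → ℝ := fun n => (-(A₁ * (Lc : ℝ)⁻¹) * (((n % (Lc : ℤ) : ℤ) : ℝ)) + cH * Φ (n / (Lc : ℤ))) / Mρ with hΨ₁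
  set Ψ₂ : ℤ → ℝ := fun n => (-(A₂ * (Lc : ℝ)⁻¹) * (((n % (Lc : ℤ) : ℤ) : ℝ)) + cH * Φ' (n / (Lc : ℤ))) / Mσ with hΨ₂
  have hΨ₁b : ∀ s, |Ψ₁ s| ≤ (|A₁| + |cH| * B) / Mρ := fun s => by
    rw [hΨ₁, abs_div, abs_of_pos hMρ0]
    exact div_le_div_of_nonneg_right (abs_Psi_le (Lc := Lc) A₁ cH Φ hΦ s) hMρ0.le
  have hΨ₂b : ∀ s, |Ψ₂ s| ≤ (|A₂| + |cH| * B') / Mσ := fun s => by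
    rw [hΨ₂, abs_div, abs_of_pos hMσ0]
    exact div_le_div_of_nonneg_right (abs_Psi_le (Lc := Lc) A₂ cH Φ' hΦ' s) hMσ0.le
  have hΨ₁f : ∀ n : ℤ, n % (Lc : ℤ) ≠ (Lc : ℤ) - 1 → A₁ * (Lc : ℝ)⁻¹ / Mρ + (Ψ₁ (n + 1) - Ψ₁ n) = 0 := fun n hn => by
    simp only [hΨ₁, hA₁, hcH]
    exact face_support_of_response hr j β c Φ hΦ Mρ n hn
  have hΨ₂f : ∀ n : ℤ, n % (Lc : ℤ) ≠ (Lc : ℤ) - 1 → A₂ * (Lc : ℝ)⁻¹ / Mσ + (Ψ₂ (n + 1) - Ψ₂ n) = 0 := fun n hn => by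
    simp only [hΨ₂, hA₂, hcH]
    exact face_support_of_response hr j ν c' Φ' hΦ' Mσ n hn
  have eH : ∀ (κ₂ : Fin (d + 1)) (q : Site (d + 1)),
      ∑' w : Site (d + 1), ρ₁ w * colH (coDressKBmAt (toSite r) Lc (KInvStep (d := d) Lc j)) Lc β w κ₂ q =
        if κ₂ = β then A₁ * (Lc : ℝ)⁻¹ / Mρ + (Ψ₁ (q β + 1) - Ψ₁ (q β)) else 0 := by
    intro κ₂ q
    have h := tsum_profile_mul_colH_eq_const_add_grad (d := d) hr j β κ₂ c Φ hΦ q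
    rw [tsum_rescale (M := Mρ) hMρ0.ne'] at h
    have h' : ∑' w : Site (d + 1), ρ₁ w * colH (coDressKBmAt (toSite r) Lc (KInvStep (d := d) Lc j)) Lc β w κ₂ q =
        (if κ₂ = β then
          (c * ((Lc : ℝ) * ((((Lc ^ (j + 1) : ℕ) : ℝ)) ^ (d + 1 + 1))⁻¹)) * (Lc : ℝ)⁻¹ +
            ((-((c * ((Lc : ℝ) * ((((Lc ^ (j + 1) : ℕ) : ℝ)) ^ (d + 1 + 1))⁻¹)) * (Lc : ℝ)⁻¹) * ((((q β + 1) % (Lc : ℤ) : ℤ) : ℝ))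
                + (stepScale d Lc j * (Lc : ℝ) ^ (d + 1))⁻¹ * Φ ((q β + 1) / (Lc : ℤ)))
              - (-((c * ((Lc : ℝ) * ((((Lc ^ (j + 1) : ℕ) : ℝ)) ^ (d + 1 + 1))⁻¹)) * (Lc : ℝ)⁻¹) * (((q β % (Lc : ℤ) : ℤ) : ℝ))
                + (stepScale d Lc j * (Lc : ℝ) ^ (d + 1))⁻¹ * Φ (q β / (Lc : ℤ))))
        else 0) / Mρ := by
      rw [← h, mul_div_cancel_left₀ _ hMρ0.ne']
    rw [h']
    split_ifs
    · simp only [hΨ₁, hA₁, hcH]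
      field_simp
    · simp
  have eσ : ∀ (κ₃ : Fin (d + 1)) (u : Site (d + 1)),
      ∑' t : Site (d + 1), σ₁ t * colH (coDressKBmAt (toSite r) Lc (KInvStep (d := d) Lc j)) Lc ν t κ₃ u =
        if κ₃ = ν then A₂ * (Lc : ℝ)⁻¹ / Mσ + (Ψ₂ (u ν + 1) - Ψ₂ (u ν)) else 0 := by
    intro κ₃ u
    have h := tsum_profile_mul_colH_eq_const_add_grad (d := d) hr j ν κ₃ c' Φ' hΦ' u
    rw [tsum_rescale (M := Mσ) hMσ0.ne'] at h
    have h' : ∑' t : Site (d + 1), σ₁ t * colH (coDressKBmAt (toSite r) Lc (KInvStep (d := d) Lc j)) Lc ν t κ₃ u =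
        (if κ₃ = ν then
          (c' * ((Lc : ℝ) * ((((Lc ^ (j + 1) : ℕ) : ℝ)) ^ (d + 1 + 1))⁻¹)) * (Lc : ℝ)⁻¹ +
            ((-((c' * ((Lc : ℝ) * ((((Lc ^ (j + 1) : ℕ) : ℝ)) ^ (d + 1 + 1))⁻¹)) * (Lc : ℝ)⁻¹) * ((((u ν + 1) % (Lc : ℤ) : ℤ) : ℝ))
                + (stepScale d Lc j * (Lc : ℝ) ^ (d + 1))⁻¹ * Φ' ((u ν + 1) / (Lc : ℤ)))
              - (-((c' * ((Lc : ℝ) * ((((Lc ^ (j + 1) : ℕ) : ℝ)) ^ (d + 1 + 1))⁻¹)) * (Lc : ℝ)⁻¹) * (((u ν % (Lc : ℤ) : ℤ) : ℝ))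
                + (stepScale d Lc j * (Lc : ℝ) ^ (d + 1))⁻¹ * Φ' (u ν / (Lc : ℤ))))
        else 0) / Mσ := by
      rw [← h, mul_div_cancel_left₀ _ hMσ0.ne']
    rw [h']
    split_ifs
    · simp only [hΨ₂, hA₂, hcH]
      field_simp
    · simp
  -- the two expansions (free leg `(y, inl μ)` second) and their sum
  have E1 := faceSlot_current_eq_tsum_freeLeg (d := d) hr j hS hδs hσb hρb ν β hMρr y μ
  have E2 := faceSlot_current_eq_tsum_freeLeg (d := d) hr j hS hδs hρb hσb β ν hMσr y μ
  -- the level-j currents, collapsed: they are the two halves of `P_S[s', h']`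
  have eT1 : ∀ (p : Site (d + 1)) (a : Fib d),
      ∑ κ₂ : Fin (d + 1), ∑' q : Site (d + 1), (∑' w : Site (d + 1), ρ₁ w * colH (coDressKBmAt (toSite r) Lc (KInvStep (d := d) Lc j)) Lc β w κ₂ q) *
          ∑ κ₃ : Fin (d + 1), ∑' u : Site (d + 1), (∑' t : Site (d + 1), σ₁ t * colH (coDressKBmAt (toSite r) Lc (KInvStep (d := d) Lc j)) Lc ν t κ₃ u) *
            S κ₃ u q p (Sum.inl κ₂) a =
      ∑' q : Site (d + 1), (A₁ * (Lc : ℝ)⁻¹ / Mρ + (Ψ₁ (q β + 1) - Ψ₁ (q β))) *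
          ∑' u : Site (d + 1), (A₂ * (Lc : ℝ)⁻¹ / Mσ + (Ψ₂ (u ν + 1) - Ψ₂ (u ν))) * S ν u q p (Sum.inl β) a := by
    intro p a
    simp only [eH, eσ]
    rw [sum_tsum_ite_dir β (fun q => A₁ * (Lc : ℝ)⁻¹ / Mρ + (Ψ₁ (q β + 1) - Ψ₁ (q β)))]
    refine tsum_congr fun q => ?_
    rw [sum_tsum_ite_dir ν (fun u => A₂ * (Lc : ℝ)⁻¹ / Mσ + (Ψ₂ (u ν + 1) - Ψ₂ (u ν)))]
  have eT2 : ∀ (p : Site (d + 1)) (a : Fib d),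
      ∑ κ₂ : Fin (d + 1), ∑' q : Site (d + 1), (∑' w : Site (d + 1), σ₁ w * colH (coDressKBmAt (toSite r) Lc (KInvStep (d := d) Lc j)) Lc ν w κ₂ q) *
          ∑ κ₃ : Fin (d + 1), ∑' u : Site (d + 1), (∑' t : Site (d + 1), ρ₁ t * colH (coDressKBmAt (toSite r) Lc (KInvStep (d := d) Lc j)) Lc β t κ₃ u) *
            S κ₃ u q p (Sum.inl κ₂) a =
      ∑' q : Site (d + 1), (A₂ * (Lc : ℝ)⁻¹ / Mσ + (Ψ₂ (q ν + 1) - Ψ₂ (q ν))) *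
          ∑' u : Site (d + 1), (A₁ * (Lc : ℝ)⁻¹ / Mρ + (Ψ₁ (u β + 1) - Ψ₁ (u β))) * S β u q p (Sum.inl ν) a := by
    intro p a
    simp only [eH, eσ]
    rw [sum_tsum_ite_dir ν (fun q => A₂ * (Lc : ℝ)⁻¹ / Mσ + (Ψ₂ (q ν + 1) - Ψ₂ (q ν)))]
    refine tsum_congr fun q => ?_
    rw [sum_tsum_ite_dir β (fun u => A₁ * (Lc : ℝ)⁻¹ / Mρ + (Ψ₁ (u β + 1) - Ψ₁ (u β)))]
  have key : ∀ (p : Site (d + 1)) (a : Fib d),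
      (∑ κ₂ : Fin (d + 1), ∑' q : Site (d + 1), (∑' w : Site (d + 1), ρ₁ w * colH (coDressKBmAt (toSite r) Lc (KInvStep (d := d) Lc j)) Lc β w κ₂ q) *
          ∑ κ₃ : Fin (d + 1), ∑' u : Site (d + 1), (∑' t : Site (d + 1), σ₁ t * colH (coDressKBmAt (toSite r) Lc (KInvStep (d := d) Lc j)) Lc ν t κ₃ u) *
            S κ₃ u q p (Sum.inl κ₂) a) +
        ∑ κ₂ : Fin (d + 1), ∑' q : Site (d + 1), (∑' w : Site (d + 1), σ₁ w * colH (coDressKBmAt (toSite r) Lc (KInvStep (d := d) Lc j)) Lc ν w κ₂ q) *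
          ∑ κ₃ : Fin (d + 1), ∑' u : Site (d + 1), (∑' t : Site (d + 1), ρ₁ t * colH (coDressKBmAt (toSite r) Lc (KInvStep (d := d) Lc j)) Lc β t κ₃ u) *
            S κ₃ u q p (Sum.inl κ₂) a = 0 := by
    intro p a
    rw [eT1, eT2]
    exact hyp (A₁ * (Lc : ℝ)⁻¹ / Mρ) Ψ₁ _ hΨ₁b hΨ₁f (A₂ * (Lc : ℝ)⁻¹ / Mσ) Ψ₂ _ hΨ₂b hΨ₂f p a
  -- undo the rescaling and conclude
  have e : ∀ (κ τ : Fin (d + 1)) (g₁ g₂ : Site (d + 1) → ℝ) (M₁ M₂ : ℝ), M₁ ≠ 0 → M₂ ≠ 0 →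
      ∑' w : Site (d + 1), g₁ w * ∑' t : Site (d + 1), g₂ t * e3OfK Lc (coDressKBmAt (toSite r) Lc (KInvStep (d := d) Lc j)) S κ t w y (Sum.inl τ) (Sum.inl μ) =
      M₁ * (M₂ * ∑' w : Site (d + 1), (g₁ w / M₁) * ∑' t : Site (d + 1), (g₂ t / M₂) * e3OfK Lc (coDressKBmAt (toSite r) Lc (KInvStep (d := d) Lc j)) S κ t w y (Sum.inl τ) (Sum.inl μ)) := by
    intro κ τ g₁ g₂ M₁ M₂ h1 h2
    have e1 : ∀ w : Site (d + 1), g₁ w = M₁ * (g₁ w / M₁) := fun w => by field_simp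
    have e2 : ∀ t : Site (d + 1), g₂ t = M₂ * (g₂ t / M₂) := fun t => by field_simp
    have e3 : ∀ w : Site (d + 1), ∑' t : Site (d + 1), g₂ t * e3OfK Lc (coDressKBmAt (toSite r) Lc (KInvStep (d := d) Lc j)) S κ t w y (Sum.inl τ) (Sum.inl μ) =
        M₂ * ∑' t : Site (d + 1), (g₂ t / M₂) * e3OfK Lc (coDressKBmAt (toSite r) Lc (KInvStep (d := d) Lc j)) S κ t w y (Sum.inl τ) (Sum.inl μ) := by
      intro w
      rw [← tsum_mul_left]
      exact tsum_congr fun t => by rw [← mul_assoc, ← e2 t]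
    calc _ = ∑' w : Site (d + 1), M₁ * (M₂ * ((g₁ w / M₁) * ∑' t : Site (d + 1), (g₂ t / M₂) *
          e3OfK Lc (coDressKBmAt (toSite r) Lc (KInvStep (d := d) Lc j)) S κ t w y (Sum.inl τ) (Sum.inl μ))) :=
          tsum_congr fun w => by rw [e3 w]; nth_rewrite 1 [e1 w]; ring
      _ = _ := by rw [tsum_mul_left, tsum_mul_left]
  rw [e ν β _ _ Mρ Mσ hMρ0.ne' hMσ0.ne', e β ν _ _ Mσ Mρ hMσ0.ne' hMρ0.ne']
  show Mρ * (Mσ * ∑' w : Site (d + 1), ρ₁ w * ∑' t : Site (d + 1), σ₁ t * e3OfK Lc (coDressKBmAt (toSite r) Lc (KInvStep (d := d) Lc j)) S ν t w y (Sum.inl β) (Sum.inl μ)) +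
    Mσ * (Mρ * ∑' w : Site (d + 1), σ₁ w * ∑' t : Site (d + 1), ρ₁ t * e3OfK Lc (coDressKBmAt (toSite r) Lc (KInvStep (d := d) Lc j)) S β t w y (Sum.inl ν) (Sum.inl μ)) = 0
  rw [E1.2, E2.2, ← mul_assoc, ← mul_assoc, mul_comm Mσ Mρ, ← mul_add, ← (E1.1).tsum_add E2.1]
  rw [show (∑' p : Site (d + 1), ((∑ a : Fib d,
        (∑ κ₂ : Fin (d + 1), ∑' q : Site (d + 1), (∑' w : Site (d + 1), ρ₁ w * colH (coDressKBmAt (toSite r) Lc (KInvStep (d := d) Lc j)) Lc β w κ₂ q) *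
          ∑ κ₃ : Fin (d + 1), ∑' u : Site (d + 1), (∑' t : Site (d + 1), σ₁ t * colH (coDressKBmAt (toSite r) Lc (KInvStep (d := d) Lc j)) Lc ν t κ₃ u) *
            S κ₃ u q p (Sum.inl κ₂) a) * coDressKBmAt (toSite r) Lc (KInvStep (d := d) Lc j) p ((Lc : ℤ) • y) a (Sum.inr μ)) +
      ∑ a : Fib d,
        (∑ κ₂ : Fin (d + 1), ∑' q : Site (d + 1), (∑' w : Site (d + 1), σ₁ w * colH (coDressKBmAt (toSite r) Lc (KInvStep (d := d) Lc j)) Lc ν w κ₂ q) *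
          ∑ κ₃ : Fin (d + 1), ∑' u : Site (d + 1), (∑' t : Site (d + 1), ρ₁ t * colH (coDressKBmAt (toSite r) Lc (KInvStep (d := d) Lc j)) Lc β t κ₃ u) *
            S κ₃ u q p (Sum.inl κ₂) a) * coDressKBmAt (toSite r) Lc (KInvStep (d := d) Lc j) p ((Lc : ℤ) • y) a (Sum.inr μ))) = 0 from ?_, mul_zero]
  refine (tsum_congr fun p => ?_).trans tsum_zero
  rw [← Finset.sum_add_distrib]
  refine Finset.sum_eq_zero fun a _ => ?_
  rw [← add_mul, key p a, zero_mul]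

end Summit.QuantumFields.BalabanUV.Beta.GAN24.CubicSectorCurrentSym

end
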